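import Summits.HodgeConjecture.HodgeConjecture.Theorems.F0P3LettersTraceFactorisation      -- ★ p823853 (p02 (g7)): PH `IsProductHaar` (+ V6 frame vocabulary `Gp`, `Places`)
import Summits.HodgeConjecture.HodgeConjecture.Theorems.F0P3ClassTokensOfRecord            -- ★ p819048 (p04 (g6)): `anisotropic_of_frame`
import Literature.NumberTheory.Automorphic.UnitaryGroupAdelicHaarOfLocal                   -- ★ (C-glob): `exists_isHaarMeasure_family_cmLocalIntegralLevel_eq_one`, `exists_isHaarMeasure_arch_eq_map_prod_rpMeasure`
import Literature.NumberTheory.Automorphic.LocalUnitaryGroupUnimodular                     -- ★ `isMulRightInvariant_cmDatum_local_three`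
import Literature.NumberTheory.Automorphic.LocalOrbitalMeasureRegular                      -- ★ `isMulRightInvariant_localEndoscopic`
import Literature.NumberTheory.Automorphic.AdelicUnitaryGroupUnimodularAnisotropic         -- ★ `isInvInvariant_cmDatum_of_anisotropic`
import Literature.NumberTheory.Automorphic.UnitaryGroupArchUnimodular                      -- ★ `modularCharacterFun_arch_eq_one`, `…_arch_antidiagOne_eq_one`, `…_arch_endoscopic_eq_one`
import Literature.NumberTheory.Rogawski1990.CMLocalAPacketMembers                          -- ★ `Gqs`, `qsForm`
import Literature.NumberTheory.Rogawski1990.GlobalAPacketMembership                        -- ★ frame lemmas `transpose_map_cmConjRingHom_eq_of_frame`, `isUnit_det_of_frame`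
import HarnessLib

/-!
# Crux `H413` — K9β ∕ ED. 4 `stub_rung0`, THE MEASURE BLOCK (rows R0 + R5 of the T8 payability tree) DISCHARGED IN-HOUSE:
# the seven Haar measures of `Rung0Witness` with their normalisations, invariances and PH `IsProductHaar`

F0∕P3 «U3-mult», cell `hodgecm-mathlib`, crux H413 (`stmt-HodgeConjecture-24833`); pen F0P3-p04 (g8) (bid 14:38:16Z (β), census 14:58Z;
typ-T8a (F2) ∕ typ-T8b 14:35:31Z «R0 + R5 PAYABLE-NOW»).  PROOF lane: theorems only (no `def`, no instance, no notation, no `sorry`),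
`--supports stmt-HodgeConjecture-24833 --as helper`.

WHAT IS PROVED.  In the frame of the letters' line (`L` CM, `H ∈ M₃(L)` with a frame `Tᴴ ι(H) T = J_{2,1}` — whence `ᵗH̄ = H`, `det H ≠ 0` —,
`H` positive definite at every complex place other than that of `ι`, `[L⁺:ℚ] ≥ 2` — whence `H` is anisotropic), THERE EXIST, for the Borel
σ-algebras throughout (the ★ K0 ∕ `FrameData` ∕ K9β convention: every measure typed `@Measure X (borel _)`, every fact under `letI := borel _`):

* `ν` — a Haar measure on `G′(𝔸_{L⁺}) = U(H)(𝔸_{L⁺}) = (cmDatum L 3 H).Adelic`, inversion invariant (`G′` anisotropic ⇒ `G′(𝔸)` unimodular,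
  ★ `isInvInvariant_cmDatum_of_anisotropic`);
* `νH_v` — Haar measures on `H(L⁺_v) = U(Φ₂)(L⁺_v) × U(Φ₁)(L⁺_v)`, right invariant (★ `isMulRightInvariant_localEndoscopic`), with
  `νH_v(K_{H,v}) = 1`, `K_{H,v} = U(Φ₂)(𝒪_v) × U(Φ₁)(𝒪_v)` (★ `exists_isHaarMeasure_apply_eq_one` on the compact open product level);
* `νG_v` — Haar measures on `G′(L⁺_v) = U(H)(L⁺_v)`, right invariant (★ `isMulRightInvariant_cmDatum_local_three`), `νG_v(U(H)(𝒪_v)) = 1`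
  (★ `exists_isHaarMeasure_family_cmLocalIntegralLevel_eq_one`);
* `νGi` — a Haar measure on `G′_∞ = U(H)(L⁺ ⊗ ℝ)`, right invariant (★ `modularCharacterFun_arch_eq_one`), finite on compacta, and SUCH THAT
  PH `IsProductHaar L H ν νGi νG` holds: `ν = (adelicProdEquiv⁻¹)_* (νGi ⊗ (finAdelicEquiv⁻¹)_* ∏′_v ((localPiEquiv v)⁻¹_* νG_v ; U(H)(𝒪_v)))`
  ON THE NOSE (★ `exists_isHaarMeasure_arch_eq_map_prod_rpMeasure` — the Weil constant absorbed at infinity);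
* `νqi`, `νHi` — Haar measures on `G_∞ = U(Φ₃)(L⁺ ⊗ ℝ)` and `H_∞ = U(Φ₂)(L⁺ ⊗ ℝ) × U(Φ₁)(L⁺ ⊗ ℝ)`, right invariant (★
  `modularCharacterFun_arch_antidiagOne_eq_one`, ★ `modularCharacterFun_arch_endoscopic_eq_one`), finite on compacta;
* `μZ_v` — Haar measures on `U(Φ₃)(L⁺_v) ∕ Z` (`Gqs L v` modulo its centre, the square-integrability currency of the Keys labels; the centre is
  closed, the quotient a locally compact group — Mathlib `QuotientGroup.instLocallyCompactSpace`).

These are EXACTLY the sixteen measure facts `isHaar_ν … isHaar_μZ` + `hPH` of the K9β structure `Rung0Witness` (F0P3-p02 (g7) rf 9bf8e454,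
§B :559–:649; T1's reducible frame abbreviations `GpAdelic ∕ HLocal ∕ GpLocal ∕ GpInf ∕ GInf ∕ HInf` ARE the carriers spelled here), in field order,
so ED. ≥ 5 of `Cruxes/H413/Lines/F0_U3LettersRung1.lean` (or the T8 pay-down line of `stub_rung0`) discharges them by ONE `obtain` from
`exists_rung0HaarPackage L ι H T hT hdef h2`; nothing here is a citation — the measure block of rung 0 is in-house mathematics
([Rogawski1990 §4.3 p. 44, §5.4 p. 72: «`dg = ⊗ dg_v`, `vol K_v = 1` for almost all `v`»; Tate, CasselsFrohlichANT1967 XV §3.3; BorelJacquet1979 §4.1]).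

NOT HERE (the rest of `Rung0Witness`): the transfer factor `Tinf`, the sign `c`, the archimedean classes `jInf dsInf`, `hquad`, and the four
booked letters `hAT` (★ `ArchTransfersExistCanonical[Singular]`), `hSET`, `hGTQ` (★ `GlobalTransferWithStabilisationPackageAnd … (Q_K9 …)`), `hc hJ hD hJU hDU`
— rows R1–R4 of the T8 tree, which are print, not measure theory.  HONEST LABEL: HC_CM is proved only modulo the printed citations until rung 0
closes; this file is unconditional and discharges only the measure-theoretic content of `stub_rung0`.

## Tree search (all ★, nothing restated)
`UnitaryGroup.exists_isHaarMeasure_family_cmLocalIntegralLevel_eq_one`, `isHaarMeasure_map_localModel_symm`, `map_localPiEquiv_symm_apply_localInt_eq_one`,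
`exists_isHaarMeasure_arch_eq_map_prod_rpMeasure` (`UnitaryGroupAdelicHaarOfLocal`); `exists_isHaarMeasure_apply_eq_one`, instances `locallyCompactSpace_cmDatum_local`,
`secondCountableTopology_cmDatum_local` (`LocalUnitaryGroupCongrMeasure`); `isCompact_isOpen_cmLocalIntegralLevel` (`LocalUnitaryIntegralLevel`);
`isMulRightInvariant_cmDatum_local_three` (`LocalUnitaryGroupUnimodular`); `isMulRightInvariant_localEndoscopic` (`LocalOrbitalMeasureRegular`);
`isInvInvariant_cmDatum_of_anisotropic` (`AdelicUnitaryGroupUnimodularAnisotropic`); `modularCharacterFun_arch_eq_one`, `modularCharacterFun_arch_antidiagOne_eq_one`,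
`modularCharacterFun_arch_endoscopic_eq_one` (`UnitaryGroupArchUnimodular`); `isMulRightInvariant_of_modularCharacterFun_eq_one` (`GLnAdelicIntegrationFactsProofs`);
instance `locallyCompactSpace_cmDatum_Adelic` (`AdelicUnitaryGroupDatum`); `F0P3ClassTokensOfRecord.anisotropic_of_frame`;
`Rogawski1990.transpose_map_cmConjRingHom_eq_of_frame`, `Rogawski1990.isUnit_det_of_frame`; `F0P3LettersTraceFactorisation.IsProductHaar`.
Mathlib: `Measure.haar`, `isHaarMeasure_haarMeasure`, `QuotientGroup.instLocallyCompactSpace`, `Set.isClosed_centralizer`, `Subgroup.coe_prod`, `IsCompact.prod`.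

References: J. Rogawski, Ann. of Math. Stud. 123 (1990) §4.3 p. 44, §5.4 p. 72 [Rogawski1990]; J. Tate in Cassels–Fröhlich (1967) Ch. XV §3.3
[CasselsFrohlichANT1967]; A. Borel, H. Jacquet, PSPM 33.1 (1979) §4.1 [BorelJacquet1979]; V. Platonov, A. Rapinchuk (1994) §3.5 [PlatonovRapinchuk1994].
-/

set_option autoImplicit false
-- the mandated namespace has the single-problem summit's repeated segment (`HodgeConjecture.HodgeConjecture`)
set_option linter.dupNamespace false

noncomputable section

namespace Summit.HodgeConjecture.HodgeConjecture.Cruxes.H413.F0P3Rung0HaarPackage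

open MeasureTheory MeasureTheory.Measure NumberField IsDedekindDomain
open Literature.NumberTheory.Automorphic Literature.NumberTheory.Automorphic.UnitaryGroup
open Literature.NumberTheory.Rogawski1990 (Gqs qsForm transpose_map_cmConjRingHom_eq_of_frame isUnit_det_of_frame)
open Summit.HodgeConjecture.HodgeConjecture.Cruxes.H413.F0P3InnerFormClassificationV6 (Gp)
open Summit.HodgeConjecture.HodgeConjecture.Cruxes.H413.F0P3LettersTraceFactorisation (IsProductHaar)
open scoped Matrix ComplexOrder

variable (L : Type) [Field L] [NumberField L] [IsCMField L] (H : Matrix (Fin 3) (Fin 3) L)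

/-! ## §1 The archimedean and quotient pieces (generic over the form) -/

/-- A Haar measure on `U(J)(L⁺ ⊗ ℝ)` exists, for the BOREL σ-algebra, and is finite on compacta and right invariant, as soon as `U(J)(L⁺ ⊗ ℝ)` is
unimodular (`Δ ≡ 1`; reductive real groups are). [cite: Knapp2002, VIII.§2 Cor. 8.31] [cite: BorelJacquet1979, §4.1] -/
theorem exists_isHaarMeasure_arch_of_modularCharacterFun_eq_one {N : ℕ} (J : Matrix (Fin N) (Fin N) L)
    (hΔ : ∀ g : ↥(UnitaryGroup.arch (↥(maximalRealSubfield L)) L (IsCMField.complexConj L) N J), modularCharacterFun g = 1) :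
    ∃ μ : @Measure ↥(UnitaryGroup.arch (↥(maximalRealSubfield L)) L (IsCMField.complexConj L) N J) (borel _),
      (letI : MeasurableSpace ↥(UnitaryGroup.arch (↥(maximalRealSubfield L)) L (IsCMField.complexConj L) N J) := borel _; μ.IsHaarMeasure) ∧
      (letI : MeasurableSpace ↥(UnitaryGroup.arch (↥(maximalRealSubfield L)) L (IsCMField.complexConj L) N J) := borel _; IsFiniteMeasureOnCompacts μ) ∧
      (letI : MeasurableSpace ↥(UnitaryGroup.arch (↥(maximalRealSubfield L)) L (IsCMField.complexConj L) N J) := borel _; μ.IsMulRightInvariant) := by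
  letI : MeasurableSpace ↥(UnitaryGroup.arch (↥(maximalRealSubfield L)) L (IsCMField.complexConj L) N J) := borel _
  haveI : BorelSpace ↥(UnitaryGroup.arch (↥(maximalRealSubfield L)) L (IsCMField.complexConj L) N J) := ⟨rfl⟩
  exact ⟨haar, inferInstance, inferInstance, isMulRightInvariant_of_modularCharacterFun_eq_one hΔ _⟩

/-- A Haar measure on a PRODUCT `U(J₁)(L⁺ ⊗ ℝ) × U(J₂)(L⁺ ⊗ ℝ)` exists, for the Borel σ-algebra of the product, finite on compacta and right invariant,
as soon as the product is unimodular (e.g. `H_∞ = U(Φ₂)_∞ × U(Φ₁)_∞`, ★ `modularCharacterFun_arch_endoscopic_eq_one`). [cite: Knapp2002, VIII.§2 Cor. 8.31] -/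
theorem exists_isHaarMeasure_arch_prod_of_modularCharacterFun_eq_one {N₁ N₂ : ℕ} (J₁ : Matrix (Fin N₁) (Fin N₁) L) (J₂ : Matrix (Fin N₂) (Fin N₂) L)
    (hΔ : ∀ g : ↥(UnitaryGroup.arch (↥(maximalRealSubfield L)) L (IsCMField.complexConj L) N₁ J₁) ×
        ↥(UnitaryGroup.arch (↥(maximalRealSubfield L)) L (IsCMField.complexConj L) N₂ J₂), modularCharacterFun g = 1) :
    ∃ μ : @Measure (↥(UnitaryGroup.arch (↥(maximalRealSubfield L)) L (IsCMField.complexConj L) N₁ J₁) ×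
        ↥(UnitaryGroup.arch (↥(maximalRealSubfield L)) L (IsCMField.complexConj L) N₂ J₂)) (borel _),
      (letI : MeasurableSpace (↥(UnitaryGroup.arch (↥(maximalRealSubfield L)) L (IsCMField.complexConj L) N₁ J₁) ×
        ↥(UnitaryGroup.arch (↥(maximalRealSubfield L)) L (IsCMField.complexConj L) N₂ J₂)) := borel _; μ.IsHaarMeasure) ∧
      (letI : MeasurableSpace (↥(UnitaryGroup.arch (↥(maximalRealSubfield L)) L (IsCMField.complexConj L) N₁ J₁) ×
        ↥(UnitaryGroup.arch (↥(maximalRealSubfield L)) L (IsCMField.complexConj L) N₂ J₂)) := borel _; IsFiniteMeasureOnCompacts μ) ∧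
      (letI : MeasurableSpace (↥(UnitaryGroup.arch (↥(maximalRealSubfield L)) L (IsCMField.complexConj L) N₁ J₁) ×
        ↥(UnitaryGroup.arch (↥(maximalRealSubfield L)) L (IsCMField.complexConj L) N₂ J₂)) := borel _; μ.IsMulRightInvariant) := by
  letI : MeasurableSpace (↥(UnitaryGroup.arch (↥(maximalRealSubfield L)) L (IsCMField.complexConj L) N₁ J₁) ×
      ↥(UnitaryGroup.arch (↥(maximalRealSubfield L)) L (IsCMField.complexConj L) N₂ J₂)) := borel _
  haveI : BorelSpace (↥(UnitaryGroup.arch (↥(maximalRealSubfield L)) L (IsCMField.complexConj L) N₁ J₁) ×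
      ↥(UnitaryGroup.arch (↥(maximalRealSubfield L)) L (IsCMField.complexConj L) N₂ J₂)) := ⟨rfl⟩
  exact ⟨haar, inferInstance, inferInstance, isMulRightInvariant_of_modularCharacterFun_eq_one hΔ _⟩

/-- A Haar measure on `U(Φ₃)(L⁺_v) ∕ Z` (the quasi-split local group `Gqs L v` modulo its centre) exists, for the Borel σ-algebra: the centre is a
closed normal subgroup (centralizer of everything in a Hausdorff group), so the quotient is a locally compact topological group. [folklore]
[cite: PlatonovRapinchuk1994, §3.5] -/
theorem exists_isHaarMeasure_gqs_quotient_center (v : HeightOneSpectrum (𝓞 ↥(maximalRealSubfield L))) :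
    ∃ μ : @Measure (Gqs L v ⧸ Subgroup.center (Gqs L v)) (borel _),
      letI : MeasurableSpace (Gqs L v ⧸ Subgroup.center (Gqs L v)) := borel _; μ.IsHaarMeasure := by
  letI : MeasurableSpace (Gqs L v ⧸ Subgroup.center (Gqs L v)) := borel _
  haveI : BorelSpace (Gqs L v ⧸ Subgroup.center (Gqs L v)) := ⟨rfl⟩
  exact ⟨haar, inferInstance⟩

/-! ## §2 The local pieces: `G′_v` normalised at `U(H)(𝒪_v)`, `H_v` normalised at `U(Φ₂)(𝒪_v) × U(Φ₁)(𝒪_v)` -/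

/-- A NORMALISED right-invariant Haar family on the `U(H)(L⁺_v)`, Borel σ-algebras: `νG_v(U(H)(𝒪_v)) = 1` (★
`exists_isHaarMeasure_family_cmLocalIntegralLevel_eq_one`; right invariance = unimodularity of `U(H)(L⁺_v)`, ★ `isMulRightInvariant_cmDatum_local_three`).
[cite: Rogawski1990, §5.4 p. 72] [cite: PlatonovRapinchuk1994, §3.5] -/
theorem exists_isHaarMeasure_family_local (hH : (H.map (cmConjRingHom L))ᵀ = H) (hHd : H.det ≠ 0) :
    ∃ νG : ∀ v : HeightOneSpectrum (𝓞 ↥(maximalRealSubfield L)), @Measure ((cmDatum L 3 H).Local v) (borel _),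
      (∀ v, letI : MeasurableSpace ((cmDatum L 3 H).Local v) := borel _; (νG v).IsHaarMeasure) ∧
      (∀ v, letI : MeasurableSpace ((cmDatum L 3 H).Local v) := borel _; (νG v).IsMulRightInvariant) ∧
      (∀ v, νG v (cmLocalIntegralLevel L 3 H v : Set ((cmDatum L 3 H).Local v)) = 1) := by
  letI : ∀ v : HeightOneSpectrum (𝓞 ↥(maximalRealSubfield L)), MeasurableSpace ((cmDatum L 3 H).Local v) := fun _ => borel _
  haveI : ∀ v : HeightOneSpectrum (𝓞 ↥(maximalRealSubfield L)), BorelSpace ((cmDatum L 3 H).Local v) := fun _ => ⟨rfl⟩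
  obtain ⟨νG, hνG, hK⟩ := exists_isHaarMeasure_family_cmLocalIntegralLevel_eq_one L 3 H
  exact ⟨νG, hνG, fun v => haveI := hνG v; isMulRightInvariant_cmDatum_local_three L H hH hHd v (νG v), hK⟩

/-- A NORMALISED right-invariant Haar family on the endoscopic `H(L⁺_v) = U(Φ₂)(L⁺_v) × U(Φ₁)(L⁺_v)`, Borel σ-algebra OF THE PRODUCT:
`νH_v(U(Φ₂)(𝒪_v) × U(Φ₁)(𝒪_v)) = 1` (the product level is compact open, ★ `isCompact_isOpen_cmLocalIntegralLevel`; ★ `exists_isHaarMeasure_apply_eq_one`;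
right invariance ★ `isMulRightInvariant_localEndoscopic`). [cite: Rogawski1990, §4.9 p. 54] [cite: PlatonovRapinchuk1994, §3.5] -/
theorem exists_isHaarMeasure_family_localEndoscopic :
    ∃ νH : ∀ v : HeightOneSpectrum (𝓞 ↥(maximalRealSubfield L)),
        @Measure ((cmDatum L 2 (Matrix.of fun i j : Fin 2 => if i.val + j.val + 1 = 2 then (1 : L) else 0)).Local v ×
          (cmDatum L 1 (Matrix.of fun i j : Fin 1 => if i.val + j.val + 1 = 1 then (1 : L) else 0)).Local v) (borel _),
      (∀ v, letI : MeasurableSpace ((cmDatum L 2 (Matrix.of fun i j : Fin 2 => if i.val + j.val + 1 = 2 then (1 : L) else 0)).Local v ×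
          (cmDatum L 1 (Matrix.of fun i j : Fin 1 => if i.val + j.val + 1 = 1 then (1 : L) else 0)).Local v) := borel _; (νH v).IsHaarMeasure) ∧
      (∀ v, letI : MeasurableSpace ((cmDatum L 2 (Matrix.of fun i j : Fin 2 => if i.val + j.val + 1 = 2 then (1 : L) else 0)).Local v ×
          (cmDatum L 1 (Matrix.of fun i j : Fin 1 => if i.val + j.val + 1 = 1 then (1 : L) else 0)).Local v) := borel _; (νH v).IsMulRightInvariant) ∧
      (∀ v, νH v (((cmLocalIntegralLevel L 2 (Matrix.of fun i j : Fin 2 => if i.val + j.val + 1 = 2 then (1 : L) else 0) v).prod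
          (cmLocalIntegralLevel L 1 (Matrix.of fun i j : Fin 1 => if i.val + j.val + 1 = 1 then (1 : L) else 0) v) :
            Subgroup ((cmDatum L 2 (Matrix.of fun i j : Fin 2 => if i.val + j.val + 1 = 2 then (1 : L) else 0)).Local v ×
              (cmDatum L 1 (Matrix.of fun i j : Fin 1 => if i.val + j.val + 1 = 1 then (1 : L) else 0)).Local v)) :
          Set ((cmDatum L 2 (Matrix.of fun i j : Fin 2 => if i.val + j.val + 1 = 2 then (1 : L) else 0)).Local v ×
            (cmDatum L 1 (Matrix.of fun i j : Fin 1 => if i.val + j.val + 1 = 1 then (1 : L) else 0)).Local v)) = 1) := by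
  letI : ∀ v : HeightOneSpectrum (𝓞 ↥(maximalRealSubfield L)),
      MeasurableSpace ((cmDatum L 2 (Matrix.of fun i j : Fin 2 => if i.val + j.val + 1 = 2 then (1 : L) else 0)).Local v ×
        (cmDatum L 1 (Matrix.of fun i j : Fin 1 => if i.val + j.val + 1 = 1 then (1 : L) else 0)).Local v) := fun _ => borel _
  haveI : ∀ v : HeightOneSpectrum (𝓞 ↥(maximalRealSubfield L)),
      BorelSpace ((cmDatum L 2 (Matrix.of fun i j : Fin 2 => if i.val + j.val + 1 = 2 then (1 : L) else 0)).Local v ×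
        (cmDatum L 1 (Matrix.of fun i j : Fin 1 => if i.val + j.val + 1 = 1 then (1 : L) else 0)).Local v) := fun _ => ⟨rfl⟩
  have h : ∀ v : HeightOneSpectrum (𝓞 ↥(maximalRealSubfield L)),
      ∃ μ : Measure ((cmDatum L 2 (Matrix.of fun i j : Fin 2 => if i.val + j.val + 1 = 2 then (1 : L) else 0)).Local v ×
        (cmDatum L 1 (Matrix.of fun i j : Fin 1 => if i.val + j.val + 1 = 1 then (1 : L) else 0)).Local v),
        IsHaarMeasure μ ∧ μ (((cmLocalIntegralLevel L 2 (Matrix.of fun i j : Fin 2 => if i.val + j.val + 1 = 2 then (1 : L) else 0) v).prod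
          (cmLocalIntegralLevel L 1 (Matrix.of fun i j : Fin 1 => if i.val + j.val + 1 = 1 then (1 : L) else 0) v) :
            Subgroup ((cmDatum L 2 (Matrix.of fun i j : Fin 2 => if i.val + j.val + 1 = 2 then (1 : L) else 0)).Local v ×
              (cmDatum L 1 (Matrix.of fun i j : Fin 1 => if i.val + j.val + 1 = 1 then (1 : L) else 0)).Local v)) : Set _) = 1 := by
    intro v
    have h₂ := isCompact_isOpen_cmLocalIntegralLevel L 2 (Matrix.of fun i j : Fin 2 => if i.val + j.val + 1 = 2 then (1 : L) else 0) v
    have h₁ := isCompact_isOpen_cmLocalIntegralLevel L 1 (Matrix.of fun i j : Fin 1 => if i.val + j.val + 1 = 1 then (1 : L) else 0) v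
    refine exists_isHaarMeasure_apply_eq_one ?_ ?_
    · rw [Subgroup.coe_prod]
      exact h₂.1.prod h₁.1
    · rw [Subgroup.coe_prod, (h₂.2.prod h₁.2).interior_eq]
      exact ⟨1, Set.mk_mem_prod (Subgroup.one_mem _) (Subgroup.one_mem _)⟩
  choose νH hνH h1 using h
  exact ⟨νH, hνH, fun v => haveI := hνH v; isMulRightInvariant_localEndoscopic L v (νH v), h1⟩

/-! ## §3 The adelic piece with PH: `ν` Haar and inversion invariant on `G′(𝔸)`, `νGi` absorbing the Weil constant -/

/-- **PH discharged**: for every anisotropic `H` and every normalised Borel Haar family `νG` on the `U(H)(L⁺_v)` there are a Haar measure `ν` on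
`U(H)(𝔸_{L⁺})`, inversion invariant, and a Haar measure `νGi` on `U(H)(L⁺ ⊗ ℝ)` with `IsProductHaar L H ν νGi νG` — `ν := haar`, and `νGi` the archimedean
factor of ★ `exists_isHaarMeasure_arch_eq_map_prod_rpMeasure` for the model family `(localPiEquiv v)⁻¹_* νG_v` (Haar, mass `1` on `localInt v`).
[cite: Rogawski1990, §4.3 p. 44; §5.4 p. 72] [cite: CasselsFrohlichANT1967, Ch. XV (Tate) §3.3] [cite: Borel1963, §5] -/
theorem exists_isProductHaar (hanis : ∀ x : Fin 3 → L, hermForm (cmConjRingHom L) H x x = 0 → x = 0)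
    (νG : ∀ v : HeightOneSpectrum (𝓞 ↥(maximalRealSubfield L)), @Measure ((cmDatum L 3 H).Local v) (borel _))
    (hνG : ∀ v, letI : MeasurableSpace ((cmDatum L 3 H).Local v) := borel _; (νG v).IsHaarMeasure)
    (hK : ∀ v, νG v (cmLocalIntegralLevel L 3 H v : Set ((cmDatum L 3 H).Local v)) = 1) :
    ∃ (ν : @Measure (cmDatum L 3 H).Adelic (borel _))
      (νGi : @Measure ↥(UnitaryGroup.arch (↥(maximalRealSubfield L)) L (IsCMField.complexConj L) 3 H) (borel _)),
      (letI : MeasurableSpace (cmDatum L 3 H).Adelic := borel _; ν.IsHaarMeasure) ∧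
      (letI : MeasurableSpace (cmDatum L 3 H).Adelic := borel _; ν.IsInvInvariant) ∧
      (letI : MeasurableSpace ↥(UnitaryGroup.arch (↥(maximalRealSubfield L)) L (IsCMField.complexConj L) 3 H) := borel _; νGi.IsHaarMeasure) ∧
      (letI : MeasurableSpace (Gp L H).Adelic := borel _; IsProductHaar L H ν νGi νG) := by
  classical
  letI mA : MeasurableSpace (cmDatum L 3 H).Adelic := borel _
  haveI : BorelSpace (cmDatum L 3 H).Adelic := ⟨rfl⟩
  letI : MeasurableSpace ↥(UnitaryGroup.arch (↥(maximalRealSubfield L)) L (IsCMField.complexConj L) 3 H) := borel _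
  haveI : BorelSpace ↥(UnitaryGroup.arch (↥(maximalRealSubfield L)) L (IsCMField.complexConj L) 3 H) := ⟨rfl⟩
  letI : ∀ v : HeightOneSpectrum (𝓞 ↥(maximalRealSubfield L)), MeasurableSpace ((cmDatum L 3 H).Local v) := fun _ => borel _
  haveI : ∀ v : HeightOneSpectrum (𝓞 ↥(maximalRealSubfield L)), BorelSpace ((cmDatum L 3 H).Local v) := fun _ => ⟨rfl⟩
  letI : ∀ v : HeightOneSpectrum (𝓞 ↥(maximalRealSubfield L)),
      MeasurableSpace ↥(«local» L (IsCMField.complexConj L) 3 H v) := fun _ => borel _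
  letI : ∀ v : HeightOneSpectrum (𝓞 ↥(maximalRealSubfield L)),
      MeasurableSpace ↥(localPi L (IsCMField.complexConj L) 3 H v) := fun _ => borel _
  haveI : ∀ v : HeightOneSpectrum (𝓞 ↥(maximalRealSubfield L)), BorelSpace ↥(localPi L (IsCMField.complexConj L) 3 H v) := fun _ => ⟨rfl⟩
  letI : MeasurableSpace (finAdelic (↥(maximalRealSubfield L)) L (IsCMField.complexConj L) 3 H) := borel _
  haveI : BorelSpace (finAdelic (↥(maximalRealSubfield L)) L (IsCMField.complexConj L) 3 H) := ⟨rfl⟩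
  haveI : ∀ v, (νG v).IsHaarMeasure := hνG
  haveI : ∀ v : HeightOneSpectrum (𝓞 ↥(maximalRealSubfield L)),
      IsHaarMeasure (Measure.map (localPiEquiv L (IsCMField.complexConj L) 3 H v).symm (νG v)) :=
    fun v => isHaarMeasure_map_localModel_symm v (localPiEquiv L (IsCMField.complexConj L) 3 H v) (νG v)
  -- `ν := haar` on `U(H)(𝔸_{L⁺})` (★ instance `locallyCompactSpace_cmDatum_Adelic`); its Haar instance is named so that the (C-glob) application below sees it
  haveI hA : IsHaarMeasure (haar : Measure (cmDatum L 3 H).Adelic) := inferInstance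
  obtain ⟨νGi, hνGi, hPH⟩ := exists_isHaarMeasure_arch_eq_map_prod_rpMeasure
    (fun v => Measure.map (localPiEquiv L (IsCMField.complexConj L) 3 H v).symm (νG v)) ∅
    (fun v _ => map_localPiEquiv_symm_apply_localInt_eq_one v (localPiEquiv L (IsCMField.complexConj L) 3 H v) rfl (νG v) (hK v))
    (haar : Measure (cmDatum L 3 H).Adelic) _ rfl
  exact ⟨haar, νGi, hA, isInvInvariant_cmDatum_of_anisotropic L H hanis _, hνGi, hA, hνGi, hνG, hK, hPH⟩

/-! ## §4 The package: the sixteen measure facts of `Rung0Witness` + PH, in field order -/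

/-- **THE MEASURE BLOCK OF `stub_rung0`, frame-free form** (`ᵗH̄ = H`, `det H ≠ 0`, `H` anisotropic): Haar measures `ν, νH_v, νG_v, νGi, νqi, νHi, μZ_v` on
`G′(𝔸)`, `H_v`, `G′_v`, `G′_∞`, `G_∞`, `H_∞`, `U(Φ₃)_v ∕ Z` — Borel σ-algebras — with: `ν` Haar and inversion invariant; `νH_v`, `νG_v` Haar, right invariant,
`νG_v(U(H)(𝒪_v)) = 1`, `νH_v(U(Φ₂)(𝒪_v) × U(Φ₁)(𝒪_v)) = 1`; `νGi, νqi, νHi` finite on compacta and right invariant; `μZ_v` Haar; and PH `IsProductHaar L H ν νGi νG`.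
The conjuncts are the fields `isHaar_ν … isHaar_μZ`, `hPH` of K9β's `Rung0Witness` VERBATIM (T1's frame abbreviations unfolded), in field order.
[cite: Rogawski1990, §4.3 p. 44; §4.9 p. 54; §5.4 p. 72] [cite: CasselsFrohlichANT1967, Ch. XV (Tate) §3.3] [cite: BorelJacquet1979, §4.1] -/
theorem exists_rung0HaarPackage_of (hH : (H.map (cmConjRingHom L))ᵀ = H) (hHd : H.det ≠ 0)
    (hanis : ∀ x : Fin 3 → L, hermForm (cmConjRingHom L) H x x = 0 → x = 0) :
    ∃ (ν : @Measure (cmDatum L 3 H).Adelic (borel _))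
      (νH : ∀ v : HeightOneSpectrum (𝓞 ↥(maximalRealSubfield L)),
        @Measure ((cmDatum L 2 (Matrix.of fun i j : Fin 2 => if i.val + j.val + 1 = 2 then (1 : L) else 0)).Local v ×
          (cmDatum L 1 (Matrix.of fun i j : Fin 1 => if i.val + j.val + 1 = 1 then (1 : L) else 0)).Local v) (borel _))
      (νG : ∀ v : HeightOneSpectrum (𝓞 ↥(maximalRealSubfield L)), @Measure ((cmDatum L 3 H).Local v) (borel _))
      (νGi : @Measure ↥(UnitaryGroup.arch (↥(maximalRealSubfield L)) L (IsCMField.complexConj L) 3 H) (borel _))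
      (νqi : @Measure ↥(UnitaryGroup.arch (↥(maximalRealSubfield L)) L (IsCMField.complexConj L) 3
        (Matrix.of fun i j : Fin 3 => if i.val + j.val + 1 = 3 then (1 : L) else 0)) (borel _))
      (νHi : @Measure (↥(UnitaryGroup.arch (↥(maximalRealSubfield L)) L (IsCMField.complexConj L) 2
          (Matrix.of fun i j : Fin 2 => if i.val + j.val + 1 = 2 then (1 : L) else 0)) ×
        ↥(UnitaryGroup.arch (↥(maximalRealSubfield L)) L (IsCMField.complexConj L) 1
          (Matrix.of fun i j : Fin 1 => if i.val + j.val + 1 = 1 then (1 : L) else 0))) (borel _))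
      (μZ : ∀ v : HeightOneSpectrum (𝓞 ↥(maximalRealSubfield L)), @Measure (Gqs L v ⧸ Subgroup.center (Gqs L v)) (borel _)),
      -- `isHaar_ν`
      (letI : MeasurableSpace (cmDatum L 3 H).Adelic := borel _; ν.IsHaarMeasure) ∧
      -- `isInvInv_ν`
      (letI : MeasurableSpace (cmDatum L 3 H).Adelic := borel _; ν.IsInvInvariant) ∧
      -- `isHaar_νH`
      (∀ v : HeightOneSpectrum (𝓞 ↥(maximalRealSubfield L)),
        letI : MeasurableSpace ((cmDatum L 2 (Matrix.of fun i j : Fin 2 => if i.val + j.val + 1 = 2 then (1 : L) else 0)).Local v ×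
          (cmDatum L 1 (Matrix.of fun i j : Fin 1 => if i.val + j.val + 1 = 1 then (1 : L) else 0)).Local v) := borel _; (νH v).IsHaarMeasure) ∧
      -- `isRightInv_νH`
      (∀ v : HeightOneSpectrum (𝓞 ↥(maximalRealSubfield L)),
        letI : MeasurableSpace ((cmDatum L 2 (Matrix.of fun i j : Fin 2 => if i.val + j.val + 1 = 2 then (1 : L) else 0)).Local v ×
          (cmDatum L 1 (Matrix.of fun i j : Fin 1 => if i.val + j.val + 1 = 1 then (1 : L) else 0)).Local v) := borel _; (νH v).IsMulRightInvariant) ∧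
      -- `isHaar_νG`
      (∀ v : HeightOneSpectrum (𝓞 ↥(maximalRealSubfield L)), letI : MeasurableSpace ((cmDatum L 3 H).Local v) := borel _; (νG v).IsHaarMeasure) ∧
      -- `isRightInv_νG`
      (∀ v : HeightOneSpectrum (𝓞 ↥(maximalRealSubfield L)), letI : MeasurableSpace ((cmDatum L 3 H).Local v) := borel _; (νG v).IsMulRightInvariant) ∧
      -- `hK`
      (∀ v : HeightOneSpectrum (𝓞 ↥(maximalRealSubfield L)), νG v (cmLocalIntegralLevel L 3 H v : Set ((cmDatum L 3 H).Local v)) = 1) ∧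
      -- `hKH`
      (∀ v : HeightOneSpectrum (𝓞 ↥(maximalRealSubfield L)),
        νH v (((cmLocalIntegralLevel L 2 (Matrix.of fun i j : Fin 2 => if i.val + j.val + 1 = 2 then (1 : L) else 0) v).prod
            (cmLocalIntegralLevel L 1 (Matrix.of fun i j : Fin 1 => if i.val + j.val + 1 = 1 then (1 : L) else 0) v) :
              Subgroup ((cmDatum L 2 (Matrix.of fun i j : Fin 2 => if i.val + j.val + 1 = 2 then (1 : L) else 0)).Local v ×
                (cmDatum L 1 (Matrix.of fun i j : Fin 1 => if i.val + j.val + 1 = 1 then (1 : L) else 0)).Local v)) :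
            Set ((cmDatum L 2 (Matrix.of fun i j : Fin 2 => if i.val + j.val + 1 = 2 then (1 : L) else 0)).Local v ×
              (cmDatum L 1 (Matrix.of fun i j : Fin 1 => if i.val + j.val + 1 = 1 then (1 : L) else 0)).Local v)) = 1) ∧
      -- `finCpt_νGi`
      (letI : MeasurableSpace ↥(UnitaryGroup.arch (↥(maximalRealSubfield L)) L (IsCMField.complexConj L) 3 H) := borel _; IsFiniteMeasureOnCompacts νGi) ∧
      -- `rightInv_νGi`
      (letI : MeasurableSpace ↥(UnitaryGroup.arch (↥(maximalRealSubfield L)) L (IsCMField.complexConj L) 3 H) := borel _; νGi.IsMulRightInvariant) ∧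
      -- `finCpt_νqi`
      (letI : MeasurableSpace ↥(UnitaryGroup.arch (↥(maximalRealSubfield L)) L (IsCMField.complexConj L) 3
        (Matrix.of fun i j : Fin 3 => if i.val + j.val + 1 = 3 then (1 : L) else 0)) := borel _; IsFiniteMeasureOnCompacts νqi) ∧
      -- `rightInv_νqi`
      (letI : MeasurableSpace ↥(UnitaryGroup.arch (↥(maximalRealSubfield L)) L (IsCMField.complexConj L) 3
        (Matrix.of fun i j : Fin 3 => if i.val + j.val + 1 = 3 then (1 : L) else 0)) := borel _; νqi.IsMulRightInvariant) ∧
      -- `finCpt_νHi`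
      (letI : MeasurableSpace (↥(UnitaryGroup.arch (↥(maximalRealSubfield L)) L (IsCMField.complexConj L) 2
          (Matrix.of fun i j : Fin 2 => if i.val + j.val + 1 = 2 then (1 : L) else 0)) ×
        ↥(UnitaryGroup.arch (↥(maximalRealSubfield L)) L (IsCMField.complexConj L) 1
          (Matrix.of fun i j : Fin 1 => if i.val + j.val + 1 = 1 then (1 : L) else 0))) := borel _; IsFiniteMeasureOnCompacts νHi) ∧
      -- `rightInv_νHi`
      (letI : MeasurableSpace (↥(UnitaryGroup.arch (↥(maximalRealSubfield L)) L (IsCMField.complexConj L) 2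
          (Matrix.of fun i j : Fin 2 => if i.val + j.val + 1 = 2 then (1 : L) else 0)) ×
        ↥(UnitaryGroup.arch (↥(maximalRealSubfield L)) L (IsCMField.complexConj L) 1
          (Matrix.of fun i j : Fin 1 => if i.val + j.val + 1 = 1 then (1 : L) else 0))) := borel _; νHi.IsMulRightInvariant) ∧
      -- `isHaar_μZ`
      (∀ v : HeightOneSpectrum (𝓞 ↥(maximalRealSubfield L)),
        letI : MeasurableSpace (Gqs L v ⧸ Subgroup.center (Gqs L v)) := borel _; (μZ v).IsHaarMeasure) ∧
      -- `hPH`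
      (letI : MeasurableSpace (Gp L H).Adelic := borel _; IsProductHaar L H ν νGi νG) := by
  obtain ⟨νG, hνG, hνGr, hK⟩ := exists_isHaarMeasure_family_local L H hH hHd
  obtain ⟨νH, hνH, hνHr, hKH⟩ := exists_isHaarMeasure_family_localEndoscopic L
  obtain ⟨ν, νGi, hν, hνi, hνGi, hPH⟩ := exists_isProductHaar L H hanis νG hνG hK
  obtain ⟨νqi, -, hνqic, hνqir⟩ := exists_isHaarMeasure_arch_of_modularCharacterFun_eq_one L
    (Matrix.of fun i j : Fin 3 => if i.val + j.val + 1 = 3 then (1 : L) else 0) (modularCharacterFun_arch_antidiagOne_eq_one L 3)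
  obtain ⟨νHi, -, hνHic, hνHir⟩ := exists_isHaarMeasure_arch_prod_of_modularCharacterFun_eq_one L
    (Matrix.of fun i j : Fin 2 => if i.val + j.val + 1 = 2 then (1 : L) else 0) (Matrix.of fun i j : Fin 1 => if i.val + j.val + 1 = 1 then (1 : L) else 0)
    (modularCharacterFun_arch_endoscopic_eq_one L)
  have hμZ := fun v : HeightOneSpectrum (𝓞 ↥(maximalRealSubfield L)) => exists_isHaarMeasure_gqs_quotient_center L v
  choose μZ hμZ using hμZ
  -- `νGi`: finite on compacta (Haar) and right invariant (`U(H)(L⁺ ⊗ ℝ)` unimodular)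
  have hνGic : letI : MeasurableSpace ↥(UnitaryGroup.arch (↥(maximalRealSubfield L)) L (IsCMField.complexConj L) 3 H) := borel _;
      IsFiniteMeasureOnCompacts νGi := by
    letI : MeasurableSpace ↥(UnitaryGroup.arch (↥(maximalRealSubfield L)) L (IsCMField.complexConj L) 3 H) := borel _
    haveI := hνGi
    infer_instance
  have hνGir : letI : MeasurableSpace ↥(UnitaryGroup.arch (↥(maximalRealSubfield L)) L (IsCMField.complexConj L) 3 H) := borel _;
      νGi.IsMulRightInvariant := by
    letI : MeasurableSpace ↥(UnitaryGroup.arch (↥(maximalRealSubfield L)) L (IsCMField.complexConj L) 3 H) := borel _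
    haveI : BorelSpace ↥(UnitaryGroup.arch (↥(maximalRealSubfield L)) L (IsCMField.complexConj L) 3 H) := ⟨rfl⟩
    haveI := hνGi
    exact isMulRightInvariant_of_modularCharacterFun_eq_one (modularCharacterFun_arch_eq_one L H hH hHd) νGi
  exact ⟨ν, νH, νG, νGi, νqi, νHi, μZ, hν, hνi, hνH, hνHr, hνG, hνGr, hK, hKH, hνGic, hνGir, hνqic, hνqir, hνHic, hνHir, hμZ, hPH⟩

/-- **THE MEASURE BLOCK OF `stub_rung0` IN THE FRAME OF THE LETTERS' LINE** (`Tᴴ ι(H) T = J_{2,1}`, `H` definite off `ι`, `[L⁺:ℚ] ≥ 2`): the frame gives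
`ᵗH̄ = H` (★ `transpose_map_cmConjRingHom_eq_of_frame`), `det H ≠ 0` (★ `isUnit_det_of_frame`) and anisotropy (★ `anisotropic_of_frame`), so
`exists_rung0HaarPackage_of` applies.  ED. ≥ 5 of `Lines/F0_U3LettersRung1.lean` discharges the sixteen measure fields + `hPH` of `Rung0Witness` by one `obtain`.
[cite: Rogawski1990, §4.3 p. 44; §4.9 p. 54; §5.4 p. 72] [cite: CasselsFrohlichANT1967, Ch. XV (Tate) §3.3] [cite: BorelJacquet1979, §4.1] -/
theorem exists_rung0HaarPackage (ι : L →+* ℂ) (T : GL (Fin 3) ℂ)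
    (hT : (T : Matrix (Fin 3) (Fin 3) ℂ)ᴴ * H.map ι * (T : Matrix (Fin 3) (Fin 3) ℂ) = Literature.Geometry.ComplexHyperbolic.BallModel.J)
    (hdef : ∀ τ' : L →+* ℂ, InfinitePlace.mk τ' ≠ InfinitePlace.mk ι → (H.map τ').PosDef)
    (h2 : 2 ≤ Module.finrank ℚ ↥(maximalRealSubfield L)) :
    ∃ (ν : @Measure (cmDatum L 3 H).Adelic (borel _))
      (νH : ∀ v : HeightOneSpectrum (𝓞 ↥(maximalRealSubfield L)),
        @Measure ((cmDatum L 2 (Matrix.of fun i j : Fin 2 => if i.val + j.val + 1 = 2 then (1 : L) else 0)).Local v ×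
          (cmDatum L 1 (Matrix.of fun i j : Fin 1 => if i.val + j.val + 1 = 1 then (1 : L) else 0)).Local v) (borel _))
      (νG : ∀ v : HeightOneSpectrum (𝓞 ↥(maximalRealSubfield L)), @Measure ((cmDatum L 3 H).Local v) (borel _))
      (νGi : @Measure ↥(UnitaryGroup.arch (↥(maximalRealSubfield L)) L (IsCMField.complexConj L) 3 H) (borel _))
      (νqi : @Measure ↥(UnitaryGroup.arch (↥(maximalRealSubfield L)) L (IsCMField.complexConj L) 3
        (Matrix.of fun i j : Fin 3 => if i.val + j.val + 1 = 3 then (1 : L) else 0)) (borel _))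
      (νHi : @Measure (↥(UnitaryGroup.arch (↥(maximalRealSubfield L)) L (IsCMField.complexConj L) 2
          (Matrix.of fun i j : Fin 2 => if i.val + j.val + 1 = 2 then (1 : L) else 0)) ×
        ↥(UnitaryGroup.arch (↥(maximalRealSubfield L)) L (IsCMField.complexConj L) 1
          (Matrix.of fun i j : Fin 1 => if i.val + j.val + 1 = 1 then (1 : L) else 0))) (borel _))
      (μZ : ∀ v : HeightOneSpectrum (𝓞 ↥(maximalRealSubfield L)), @Measure (Gqs L v ⧸ Subgroup.center (Gqs L v)) (borel _)),
      (letI : MeasurableSpace (cmDatum L 3 H).Adelic := borel _; ν.IsHaarMeasure) ∧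
      (letI : MeasurableSpace (cmDatum L 3 H).Adelic := borel _; ν.IsInvInvariant) ∧
      (∀ v : HeightOneSpectrum (𝓞 ↥(maximalRealSubfield L)),
        letI : MeasurableSpace ((cmDatum L 2 (Matrix.of fun i j : Fin 2 => if i.val + j.val + 1 = 2 then (1 : L) else 0)).Local v ×
          (cmDatum L 1 (Matrix.of fun i j : Fin 1 => if i.val + j.val + 1 = 1 then (1 : L) else 0)).Local v) := borel _; (νH v).IsHaarMeasure) ∧
      (∀ v : HeightOneSpectrum (𝓞 ↥(maximalRealSubfield L)),
        letI : MeasurableSpace ((cmDatum L 2 (Matrix.of fun i j : Fin 2 => if i.val + j.val + 1 = 2 then (1 : L) else 0)).Local v ×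
          (cmDatum L 1 (Matrix.of fun i j : Fin 1 => if i.val + j.val + 1 = 1 then (1 : L) else 0)).Local v) := borel _; (νH v).IsMulRightInvariant) ∧
      (∀ v : HeightOneSpectrum (𝓞 ↥(maximalRealSubfield L)), letI : MeasurableSpace ((cmDatum L 3 H).Local v) := borel _; (νG v).IsHaarMeasure) ∧
      (∀ v : HeightOneSpectrum (𝓞 ↥(maximalRealSubfield L)), letI : MeasurableSpace ((cmDatum L 3 H).Local v) := borel _; (νG v).IsMulRightInvariant) ∧
      (∀ v : HeightOneSpectrum (𝓞 ↥(maximalRealSubfield L)), νG v (cmLocalIntegralLevel L 3 H v : Set ((cmDatum L 3 H).Local v)) = 1) ∧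
      (∀ v : HeightOneSpectrum (𝓞 ↥(maximalRealSubfield L)),
        νH v (((cmLocalIntegralLevel L 2 (Matrix.of fun i j : Fin 2 => if i.val + j.val + 1 = 2 then (1 : L) else 0) v).prod
            (cmLocalIntegralLevel L 1 (Matrix.of fun i j : Fin 1 => if i.val + j.val + 1 = 1 then (1 : L) else 0) v) :
              Subgroup ((cmDatum L 2 (Matrix.of fun i j : Fin 2 => if i.val + j.val + 1 = 2 then (1 : L) else 0)).Local v ×
                (cmDatum L 1 (Matrix.of fun i j : Fin 1 => if i.val + j.val + 1 = 1 then (1 : L) else 0)).Local v)) :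
            Set ((cmDatum L 2 (Matrix.of fun i j : Fin 2 => if i.val + j.val + 1 = 2 then (1 : L) else 0)).Local v ×
              (cmDatum L 1 (Matrix.of fun i j : Fin 1 => if i.val + j.val + 1 = 1 then (1 : L) else 0)).Local v)) = 1) ∧
      (letI : MeasurableSpace ↥(UnitaryGroup.arch (↥(maximalRealSubfield L)) L (IsCMField.complexConj L) 3 H) := borel _; IsFiniteMeasureOnCompacts νGi) ∧
      (letI : MeasurableSpace ↥(UnitaryGroup.arch (↥(maximalRealSubfield L)) L (IsCMField.complexConj L) 3 H) := borel _; νGi.IsMulRightInvariant) ∧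
      (letI : MeasurableSpace ↥(UnitaryGroup.arch (↥(maximalRealSubfield L)) L (IsCMField.complexConj L) 3
        (Matrix.of fun i j : Fin 3 => if i.val + j.val + 1 = 3 then (1 : L) else 0)) := borel _; IsFiniteMeasureOnCompacts νqi) ∧
      (letI : MeasurableSpace ↥(UnitaryGroup.arch (↥(maximalRealSubfield L)) L (IsCMField.complexConj L) 3
        (Matrix.of fun i j : Fin 3 => if i.val + j.val + 1 = 3 then (1 : L) else 0)) := borel _; νqi.IsMulRightInvariant) ∧
      (letI : MeasurableSpace (↥(UnitaryGroup.arch (↥(maximalRealSubfield L)) L (IsCMField.complexConj L) 2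
          (Matrix.of fun i j : Fin 2 => if i.val + j.val + 1 = 2 then (1 : L) else 0)) ×
        ↥(UnitaryGroup.arch (↥(maximalRealSubfield L)) L (IsCMField.complexConj L) 1
          (Matrix.of fun i j : Fin 1 => if i.val + j.val + 1 = 1 then (1 : L) else 0))) := borel _; IsFiniteMeasureOnCompacts νHi) ∧
      (letI : MeasurableSpace (↥(UnitaryGroup.arch (↥(maximalRealSubfield L)) L (IsCMField.complexConj L) 2
          (Matrix.of fun i j : Fin 2 => if i.val + j.val + 1 = 2 then (1 : L) else 0)) ×
        ↥(UnitaryGroup.arch (↥(maximalRealSubfield L)) L (IsCMField.complexConj L) 1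
          (Matrix.of fun i j : Fin 1 => if i.val + j.val + 1 = 1 then (1 : L) else 0))) := borel _; νHi.IsMulRightInvariant) ∧
      (∀ v : HeightOneSpectrum (𝓞 ↥(maximalRealSubfield L)),
        letI : MeasurableSpace (Gqs L v ⧸ Subgroup.center (Gqs L v)) := borel _; (μZ v).IsHaarMeasure) ∧
      (letI : MeasurableSpace (Gp L H).Adelic := borel _; IsProductHaar L H ν νGi νG) :=
  exists_rung0HaarPackage_of L H (transpose_map_cmConjRingHom_eq_of_frame L ι H T hT) (isUnit_det_of_frame L ι H T hT).ne_zero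
    (F0P3ClassTokensOfRecord.anisotropic_of_frame L H ι hdef h2)

end Summit.HodgeConjecture.HodgeConjecture.Cruxes.H413.F0P3Rung0HaarPackage

end
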